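import Mathlib
import Literature.Analysis.SpecialFunctions.BesselHeatKernel
import HarnessLib

/-!
# Continuity of `I_ν` and of the radial heat kernels in the ORDER `ν`

For fixed argument the series `P_ν(u) = ∑_k u^k/(k! Γ(k+ν+1))` of `BesselIRealOrder.lean` depends continuously on `ν ∈ [0,∞)`
(`continuousOn_besselP_order`: uniform summability from `Γ(k+ν+1) ≥ k! Γ(ν+1) ≥ k!/e`, using the elementary bound `Γ(s) ≥ e⁻¹`
for `s ≥ 1`, `exp_neg_one_le_Gamma`); hence so do `I_ν(w)` (`continuousOn_besselIR_order`) and the radial heat kernel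
`q^{(ν)}_t(x,y)` (`continuousOn_besselHeatKernel_order`), in particular `q^{(ν)}_t(x,y) → q^{(0)}_t(x,y)` as `ν → 0⁺`
(`tendsto_besselHeatKernel_order_zero`) — the «zero-mode» continuity [DLMF 10.25.2; RevuzYor1999, Ch. XI §1].

## References
* NIST DLMF §10.25.2, §5.9. [DLMF]
* D. Revuz, M. Yor, *Continuous Martingales and Brownian Motion*, 3rd ed. (1999), Ch. XI §1. [RevuzYor1999]
-/

noncomputable section

open Filter Topology Real MeasureTheory Set
open scoped Nat BigOperators

namespace Literature.Analysis.SpecialFunctions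

/-! ## A lower bound for `Γ` on `[1,∞)` -/

/-- `Γ(s) ≥ e⁻¹` for `s ≥ 1` (`Γ(s) ≥ ∫_1^∞ e^{-x} x^{s-1} dx ≥ ∫_1^∞ e^{-x} dx`). [cite: DLMF, 5.9.1] -/
theorem exp_neg_one_le_Gamma {s : ℝ} (hs : 1 ≤ s) : Real.exp (-1) ≤ Real.Gamma s := by
  have hs0 : 0 < s := by linarith
  rw [Real.Gamma_eq_integral hs0]
  have hint := Real.GammaIntegral_convergent hs0
  have hnn : ∀ x ∈ Ioi (0 : ℝ), 0 ≤ Real.exp (-x) * x ^ (s - 1) := fun x hx =>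
    mul_nonneg (Real.exp_nonneg _) (Real.rpow_nonneg (le_of_lt hx) _)
  calc Real.exp (-1) = ∫ x in Ioi (1 : ℝ), Real.exp (-x) := (integral_exp_neg_Ioi 1).symm
    _ ≤ ∫ x in Ioi (1 : ℝ), Real.exp (-x) * x ^ (s - 1) := by
        refine setIntegral_mono_on ?_ (hint.mono_set fun x (hx : (1 : ℝ) < x) => show (0 : ℝ) < x by linarith)
          measurableSet_Ioi fun x hx => ?_
        · exact integrableOn_exp_neg_Ioi 1
        · have hx1 : (1 : ℝ) ≤ x := le_of_lt hx
          have := Real.one_le_rpow hx1 (by linarith : 0 ≤ s - 1)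
          nlinarith [Real.exp_pos (-x)]
    _ ≤ ∫ x in Ioi (0 : ℝ), Real.exp (-x) * x ^ (s - 1) :=
        setIntegral_mono_set hint (ae_restrict_of_forall_mem measurableSet_Ioi hnn)
          (ae_of_all _ fun x (hx : (1 : ℝ) < x) => show (0 : ℝ) < x by linarith)

/-- Uniform bound on the Bessel coefficients for `ν ≥ 0`: `1/(k! Γ(k+ν+1)) ≤ e/(k!)²`. [cite: DLMF, 10.25.2] -/
theorem besselPCoeff_le_exp_div {ν : ℝ} (hν : 0 ≤ ν) (k : ℕ) :
    besselPCoeff ν k ≤ Real.exp 1 / ((k ! : ℝ) * k !) := by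
  have h1 := besselPCoeff_le hν k
  have hG : Real.exp (-1) ≤ Real.Gamma (ν + 1) := exp_neg_one_le_Gamma (by linarith)
  have hk : (0 : ℝ) < k ! := by exact_mod_cast Nat.factorial_pos k
  have he : 0 < Real.exp (-1) := Real.exp_pos _
  calc besselPCoeff ν k ≤ 1 / ((k ! : ℝ) * ((k ! : ℝ) * Real.Gamma (ν + 1))) := h1
    _ ≤ 1 / ((k ! : ℝ) * ((k ! : ℝ) * Real.exp (-1))) := by
        gcongr
    _ = Real.exp 1 / ((k ! : ℝ) * k !) := by
        rw [Real.exp_neg]; field_simp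

/-! ## Continuity in the order -/

/-- `ν ↦ 1/(k! Γ(k+ν+1))` is continuous on `[0,∞)`. [cite: DLMF, 10.25.2] -/
theorem continuousOn_besselPCoeff_order (k : ℕ) : ContinuousOn (fun ν : ℝ => besselPCoeff ν k) (Ici 0) := by
  intro ν hν
  have hν' : (0 : ℝ) ≤ ν := hν
  have hpos : 0 < (k : ℝ) + ν + 1 := by positivity
  have hGc : ContinuousAt Real.Gamma ((k : ℝ) + ν + 1) := by
    refine (Real.differentiableAt_Gamma fun m => ?_).continuousAt
    have : (0 : ℝ) ≤ m := Nat.cast_nonneg m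
    intro h; linarith
  have hlin : ContinuousAt (fun ν : ℝ => (k : ℝ) + ν + 1) ν := (by fun_prop : Continuous fun ν : ℝ => (k : ℝ) + ν + 1).continuousAt
  have hcomp : ContinuousAt (fun ν : ℝ => Real.Gamma ((k : ℝ) + ν + 1)) ν := ContinuousAt.comp (g := Real.Gamma) hGc hlin
  unfold besselPCoeff
  refine (continuousAt_const.div (continuousAt_const.mul hcomp) ?_).continuousWithinAt
  exact mul_ne_zero (by positivity) (Real.Gamma_pos_of_pos hpos).ne'

/-- **`ν ↦ P_ν(u)` is continuous on `[0,∞)`** (uniformly summable series). [cite: DLMF, 10.25.2] -/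
theorem continuousOn_besselP_order (u : ℝ) : ContinuousOn (fun ν : ℝ => besselP ν u) (Ici 0) := by
  unfold besselP
  refine continuousOn_tsum (fun k => (continuousOn_besselPCoeff_order k).mul continuousOn_const)
    ((Real.summable_pow_div_factorial |u|).mul_left (Real.exp 1)) fun k ν hν => ?_
  have hν' : (0 : ℝ) ≤ ν := hν
  have hk : (1 : ℝ) ≤ k ! := by exact_mod_cast Nat.succ_le_of_lt (Nat.factorial_pos k)
  have hk0 : (0 : ℝ) < k ! := by positivity
  rw [Real.norm_eq_abs, abs_mul, abs_of_pos (besselPCoeff_pos hν' k), abs_pow]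
  calc besselPCoeff ν k * |u| ^ k ≤ Real.exp 1 / ((k ! : ℝ) * k !) * |u| ^ k :=
        mul_le_mul_of_nonneg_right (besselPCoeff_le_exp_div hν' k) (by positivity)
    _ ≤ Real.exp 1 / ((k ! : ℝ) * 1) * |u| ^ k := by gcongr
    _ = Real.exp 1 * (|u| ^ k / k !) := by field_simp

/-- **`ν ↦ I_ν(w)` is continuous on `[0,∞)`** for `w > 0`. [cite: DLMF, 10.25.2] -/
theorem continuousOn_besselIR_order {w : ℝ} (hw : 0 < w) : ContinuousOn (fun ν : ℝ => besselIR ν w) (Ici 0) := by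
  unfold besselIR
  refine ContinuousOn.mul ?_ (continuousOn_besselP_order _)
  exact fun ν _ => (Real.continuousAt_const_rpow (b := ν) (by positivity : w / 2 ≠ 0)).continuousWithinAt

/-- **The radial heat kernel is continuous in its index** on `[0,∞)` (`t, x, y > 0`). [cite: RevuzYor1999, Ch. XI §1] -/
theorem continuousOn_besselHeatKernel_order {t x y : ℝ} (ht : 0 < t) (hx : 0 < x) (hy : 0 < y) :
    ContinuousOn (fun ν : ℝ => besselHeatKernel ν t x y) (Ici 0) := by
  unfold besselHeatKernel
  exact continuousOn_const.mul (continuousOn_besselIR_order (by positivity))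

/-- **Zero-mode continuity**: `q^{(ν)}_t(x,y) → q^{(0)}_t(x,y)` as `ν → 0⁺`. [cite: RevuzYor1999, Ch. XI §1] -/
theorem tendsto_besselHeatKernel_order_zero {t x y : ℝ} (ht : 0 < t) (hx : 0 < x) (hy : 0 < y) :
    Tendsto (fun ν : ℝ => besselHeatKernel ν t x y) (𝓝[>] 0) (𝓝 (besselHeatKernel 0 t x y)) := by
  have h := (continuousOn_besselHeatKernel_order ht hx hy) 0 (by simp)
  exact (h.tendsto).mono_left (nhdsWithin_mono _ fun ν (hν : (0 : ℝ) < ν) => show (0 : ℝ) ≤ ν from le_of_lt hν)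

end Literature.Analysis.SpecialFunctions

end
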